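import Summits.BirchSwinnertonDyer.Rank1Residual.X11b.BDPRouteNonsingularTorsionDivisible
import Summits.BirchSwinnertonDyer.Rank1Residual.X11b.LocalTrivialityBridge
import HarnessLib

/-!
# Route `ErratumRoadFive`, crux 19715 `EulerHalfNotRamNoInertSetAtFive`, line `kato_Fframe` (r5.4), stub S1Λ
# `stub_katoLambdaLogBoundTamagawa` — HELPER R-C (L), part 1: the DOOR-LIFT INPUT on `E(K̄)^{I_v}` at a finite `v ∤ p` (any reduction type)

Seat `bsd-line-er5-p1` (LEAD g9), `--supports stmt-BirchSwinnertonDyer-19715` (helper). Theorems only: no definition, no named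
fact, no instance, no notation, no `sorry`. No summit statement is proved here; BSD is proved for no curve.

## What

g40's door `…Theorems.ErratumRoadFiveKatoFframeDoorLift.comap_map_unramifiedSubgroup_eq_sup_ker_of_lift`
(`ι_{k,v}⁻¹(H¹_ur(K_v, E[p^∞])) = H¹_ur(K_v, E[p^k]) ⊔ ker ι_{k,v}`) takes the ARITHMETIC hypothesis `hlift`: every inertia-fixed
`y ∈ E[p^∞]` whose class in `N / p^k N` (`N = E[p^∞]^{I_v} = E(K_v^{nr})[p^∞]`) is `Γ_{K_v}`-fixed is congruent modulo `p^k N` to a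
`Γ_{K_v}`-fixed point. THIS FILE proves `hlift` for ALL `k ≥ c_v` at EVERY finite place `v ∤ p` (good, multiplicative or additive),
the residual R-C input (L) of the LEAD brief `Cruxes/EulerHalfNotRamNoInertSetAtFive/Lines/kato_Fframe_r5_RC_rethread_brief.md`.

Proof (Greenberg, LNM 1716, §3 Lemma 3.3, p. 87; §4 p. 74; Silverman *AEC* VII.§2, VII.6): with `M₀ = E₀(K_v^{nr})^{alg}` route p2's
`nonsingularPart` (points of `E(K̄)^{I_v}` with non-singular reduction on the minimal model) —
* §1 (generic, any `φ`-stable finite-index `M₀ ≤ E(K̄)^{I_v}` with `p`-divisible `M₀[p^∞]` and finite `D_v`-fixed `p^∞`-torsion):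
  `p^c · N ⊆ M₀` for `c = v_p [E(K̄)^{I_v} : M₀]` (`exists_forall_pow_smul_mem`); `M₀[p^∞] ⊆ p^k N` (`exists_pow_nsmul_eq_of_mem`);
  `φ − 1` maps `M₀[p^∞]` ONTO itself (`exists_inertiaSubOne_eq_of_divisible`, route p2's block verbatim:
  tree `PrimaryGroup.le_range_of_finite_ker`); hence the LIFT (`exists_sub_mem_ker_inertiaSubOne`): for `k ≥ c`, if
  `(φ − 1) y ∈ p^k N (⊆ M₀)` then `(φ − 1) y = (φ − 1) n₀` with `n₀ ∈ M₀[p^∞] ⊆ p^k N`, and `m = y − n₀ ∈ ker (φ − 1)`.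
* §2 `M₀ = nonsingularPart`: the four hypotheses are route p2's theorems (`finiteIndex_nonsingularPart` = Kodaira–Néron over `K_v^{nr}`,
  `inertiaSubOne_mem_nonsingularPart`, `exists_nsmul_eq_of_mem_nonsingularPart_of_localDivisible` + `localDivisible_nonsingular_torsion`,
  `finite_setOf_smul_decomp_eq_of_isPrimary`), and `ker (φ − 1) = E(K̄)^{D_v}` (`inertiaSubOne_eq_zero_iff`).
* (part 2, `…LocalLift.lean`) translates §2 into the currency of the bsd-cm chain (binder (L) verbatim) and adds binder (E).

References: [GreenbergLNM1716] §3 Lemma 3.1 (p. 86), Lemma 3.3 (p. 87), §4 proof of Thm. 4.1 (p. 74); [SilvermanAEC2009] VII.§2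
(Prop. 2.1), Thm. VII.6.1 / Cor. VII.6.2; [MilneADT2006] Ch. I Prop. 3.8; [NeukirchANT1999] Ch. II §9 Prop. (9.6).
-/

noncomputable section

open scoped Classical NNReal ContRepresentation

open NumberField IsDedekindDomain Field IsDedekindDomain.HeightOneSpectrum WeierstrassCurve
open Literature.NumberTheory.EllipticCurves Literature.NumberTheory.EllipticCurves.GreenbergSelmer
open Literature.NumberTheory.GaloisRepresentations
open Summit.BirchSwinnertonDyer.Rank1Residual.X11b.AcSelmer Summit.BirchSwinnertonDyer.Rank1Residual.X11b.LocBridge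

set_option linter.dupNamespace false

universe u

namespace Summit.BirchSwinnertonDyer.BirchSwinnertonDyer.Theorems.ErratumRoadFiveKatoFframeLocalLiftFixedPoints

variable {K : Type u} [Field K] [NumberField K] (W : WeierstrassCurve K) {p : ℕ} [Fact p.Prime]
  {v : HeightOneSpectrum (𝓞 K)}

/-! ## §1 Generic: a `φ`-stable finite-index `M₀ ≤ E(K̄)^{I_v}` with `p`-divisible `M₀[p^∞]` -/

section Generic

variable {φ : absoluteGaloisGroup K} (hφ : IsArithFrobAt (𝓞 K) φ (adicCompletionPrime K v)) (hφD : φ ∈ decomp v)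
  (M₀ : AddSubgroup ↥(FixedPoints.addSubgroup ↥((adicCompletionPrime K v).inertia (absoluteGaloisGroup K)) W.geomPoints))

include hφ in
/-- **`φ − 1` maps `M₀[p^∞]` ONTO itself** when `M₀ ≤ E(K̄)^{I_v}` is `φ`-stable with `p`-divisible `M₀[p^∞]` and the `D_v`-fixed
`p`-power torsion of `E(K̄)` is finite (route p2's block of `natCard_localKer_le_pow_padicValNat_relIndex_of_divisible`, verbatim:
`φ − 1` is an endomorphism of the `p`-primary group `M₀[p^∞]` with finite kernel, tree `PrimaryGroup.le_range_of_finite_ker`).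
Greenberg: "`(B_v)_{div} ⊆ (γ_v − 1)B_v`". [cite: GreenbergLNM1716, §3 Lemma 3.1 (p. 86) and Lemma 3.3 (p. 87)] -/
theorem exists_inertiaSubOne_eq_of_divisible [W.IsElliptic]
    (hM₀ : ∀ x ∈ M₀, inertiaSubOne W.geomPoints φ hφD x ∈ M₀)
    (hdiv : ∀ b ∈ AddCommGroup.primaryComponent
        ↥(FixedPoints.addSubgroup ↥((adicCompletionPrime K v).inertia (absoluteGaloisGroup K)) W.geomPoints) p, b ∈ M₀ →
      ∃ b' ∈ AddCommGroup.primaryComponent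
          ↥(FixedPoints.addSubgroup ↥((adicCompletionPrime K v).inertia (absoluteGaloisGroup K)) W.geomPoints) p,
        b' ∈ M₀ ∧ p • b' = b)
    (hfin : Set.Finite {m : W.geomPoints | (∀ x ∈ decomp v, x • m = m) ∧ ∃ k : ℕ, p ^ k • m = 0}) :
    ∀ b ∈ AddCommGroup.primaryComponent
        ↥(FixedPoints.addSubgroup ↥((adicCompletionPrime K v).inertia (absoluteGaloisGroup K)) W.geomPoints) p, b ∈ M₀ →
      ∃ b' ∈ AddCommGroup.primaryComponent
          ↥(FixedPoints.addSubgroup ↥((adicCompletionPrime K v).inertia (absoluteGaloisGroup K)) W.geomPoints) p,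
        b' ∈ M₀ ∧ inertiaSubOne W.geomPoints φ hφD b' = b := by
  have hp : p.Prime := Fact.out
  set ψ := inertiaSubOne W.geomPoints φ hφD with hψ
  let Mfix := FixedPoints.addSubgroup ↥((adicCompletionPrime K v).inertia (absoluteGaloisGroup K)) W.geomPoints
  let B : AddSubgroup Mfix := AddCommGroup.primaryComponent Mfix p
  let B₀ : AddSubgroup Mfix := B ⊓ M₀
  have hB₀ψ : ∀ x ∈ B₀, ψ x ∈ B₀ := fun x hx ↦
    ⟨PrimaryCoinvariants.map_mem_primaryComponent p ψ hx.1, hM₀ x hx.2⟩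
  let ψ₀ : B₀ →+ B₀ := (ψ.comp B₀.subtype).codRestrict B₀ fun b ↦ hB₀ψ b b.2
  have hψ₀ : ∀ b : B₀, ((ψ₀ b : B₀) : Mfix) = ψ b := fun _ ↦ rfl
  have hprim : ∀ b : B₀, ∃ k : ℕ, p ^ k • b = 0 := fun b ↦ by
    obtain ⟨k, hk⟩ := (AddCommGroup.mem_primaryComponent).mp b.2.1
    exact ⟨k, Subtype.ext hk⟩
  haveI : Finite (AddSubgroup.torsionBy (↥B₀) p) := by
    haveI : Finite (W.geomTorsion (p : ℤ)) :=
      W.finite_torsionPoints_holds (AlgebraicClosure K) (by exact_mod_cast hp.ne_zero)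
    refine Finite.of_injective (fun x : AddSubgroup.torsionBy (↥B₀) p ↦
      (⟨(((x : B₀) : Mfix) : W.geomPoints), ?_⟩ : W.geomTorsion (p : ℤ))) ?_
    · have hx := AddSubgroup.torsionBy.nsmul_iff.mp x.2
      have h1 : p • (((x : B₀) : Mfix) : W.geomPoints) = 0 := by
        have := congrArg (fun z : B₀ ↦ ((z : Mfix) : W.geomPoints)) hx
        simpa only [AddSubgroupClass.coe_nsmul, ZeroMemClass.coe_zero] using this
      exact AddSubgroup.torsionBy.nsmul_iff.mpr h1
    · intro a b hab
      apply Subtype.ext; apply Subtype.ext; apply Subtype.ext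
      exact congrArg (fun z : W.geomTorsion (p : ℤ) ↦ (z : W.geomPoints)) hab
  have hD : ∀ d ∈ (⊤ : AddSubgroup B₀), ∃ d' ∈ (⊤ : AddSubgroup B₀), p • d' = d := by
    intro d _
    obtain ⟨b', hb'B, hb'M₀, hb'⟩ := hdiv (d : Mfix) d.2.1 d.2.2
    exact ⟨⟨b', hb'B, hb'M₀⟩, AddSubgroup.mem_top _, Subtype.ext hb'⟩
  haveI : Finite ψ₀.ker := by
    haveI := hfin.to_subtype
    refine Finite.of_injective (fun x : ψ₀.ker ↦ (⟨((((x : B₀) : Mfix)) : W.geomPoints), ?_, ?_⟩ :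
      {m : W.geomPoints | (∀ x ∈ decomp v, x • m = m) ∧ ∃ k : ℕ, p ^ k • m = 0})) ?_
    · have h0 : ψ ((x : B₀) : Mfix) = 0 := by
        have := congrArg (fun z : B₀ ↦ (z : Mfix)) ((AddMonoidHom.mem_ker).mp x.2)
        simpa only [hψ₀, ZeroMemClass.coe_zero] using this
      exact (inertiaSubOne_eq_zero_iff W hφ hφD _).mp h0
    · obtain ⟨k, hk⟩ := hprim (x : B₀)
      refine ⟨k, ?_⟩
      have := congrArg (fun z : B₀ ↦ ((z : Mfix) : W.geomPoints)) hk
      simpa only [AddSubgroupClass.coe_nsmul, ZeroMemClass.coe_zero] using this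
    · intro a b hab
      have h := congrArg Subtype.val hab
      dsimp only at h
      exact Subtype.ext (Subtype.ext (Subtype.ext h))
  have honto : (⊤ : AddSubgroup B₀) ≤ ψ₀.range :=
    PrimaryGroup.le_range_of_finite_ker p hprim hD ψ₀ (fun _ _ ↦ AddSubgroup.mem_top _)
  intro b hbB hbM₀
  obtain ⟨x, hx⟩ := honto (AddSubgroup.mem_top (⟨b, hbB, hbM₀⟩ : B₀))
  refine ⟨((x : B₀) : Mfix), x.2.1, x.2.2, ?_⟩
  have := congrArg (fun z : B₀ ↦ (z : Mfix)) hx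
  simpa only [hψ₀] using this

/-- **`p^c · N ⊆ M₀` with `c = v_p [E(K̄)^{I_v} : M₀]`**, `N = E(K̄)^{I_v}[p^∞]`: for a `p`-power torsion inertia-fixed `b`,
`d • b ∈ M₀` for `d = [E(K̄)^{I_v} : M₀]` (`AddSubgroup.nsmul_index_mem`), `d = p^c u` with `p ∤ u`, and `u` is invertible modulo the
(`p`-power) order of `b` (Bézout). Intended `M₀ = E₀(K_v^{nr})^{alg}`, `d ∣ #Φ_v(k̄_v)` (Kodaira–Néron).
[cite: SilvermanAEC2009, Thm. VII.6.1 and Cor. VII.6.2] [cite: GreenbergLNM1716, §4 proof of Thm. 4.1 (p. 74)] -/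
theorem exists_forall_pow_smul_mem [M₀.FiniteIndex] :
    ∃ c : ℕ, ∀ b ∈ AddCommGroup.primaryComponent
        ↥(FixedPoints.addSubgroup ↥((adicCompletionPrime K v).inertia (absoluteGaloisGroup K)) W.geomPoints) p,
      ∀ k, c ≤ k → p ^ k • b ∈ M₀ := by
  have hp : p.Prime := Fact.out
  set d : ℕ := M₀.index with hd
  have hd0 : d ≠ 0 := AddSubgroup.FiniteIndex.index_ne_zero
  refine ⟨d.factorization p, fun b hb k hk ↦ ?_⟩
  set c : ℕ := d.factorization p with hc
  set u : ℕ := d / p ^ c with hu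
  have hdcu : p ^ c * u = d := Nat.ordProj_mul_ordCompl_eq_self d p
  have hpu : Nat.Coprime p u := Nat.coprime_ordCompl hp hd0
  obtain ⟨r, hr⟩ := (AddCommGroup.mem_primaryComponent).mp hb
  -- Bézout: `a * u + b' * p^r = 1`
  have hcop : IsCoprime (u : ℤ) ((p : ℤ) ^ r) := by
    rw [← Nat.cast_pow, Nat.isCoprime_iff_coprime]
    exact (Nat.Coprime.pow_left r hpu).symm
  obtain ⟨a, b', hab⟩ := hcop
  have hdb : d • b ∈ M₀ := M₀.nsmul_index_mem b
  -- `p^c • b = a • (d • b)`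
  have hkey : p ^ c • b = a • (d • b) := by
    have h1 : a • (d • b) = (a * (d : ℤ)) • b := by rw [← natCast_zsmul b d, smul_smul]
    have h2 : a * (d : ℤ) = ((p ^ c : ℕ) : ℤ) + (-(b' * (p : ℤ) ^ c)) * ((p ^ r : ℕ) : ℤ) := by
      rw [← hdcu]; push_cast; linear_combination (p : ℤ) ^ c * hab
    rw [h1, h2, add_smul, ← smul_smul, natCast_zsmul, natCast_zsmul, hr, smul_zero, add_zero]
  have hcb : p ^ c • b ∈ M₀ := by rw [hkey]; exact M₀.zsmul_mem hdb a
  obtain ⟨j, rfl⟩ := Nat.exists_eq_add_of_le hk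
  rw [pow_add, mul_comm, mul_smul]
  exact M₀.nsmul_mem hcb _

omit [Fact p.Prime] in
/-- **`M₀[p^∞] ⊆ p^k N` for every `k`**: iterate the `p`-divisibility of `M₀[p^∞]` (intended: `E₀(K_v^{nr})[p^∞] ≅ Ẽ_ns(k̄_v)[p^∞]` is
divisible, Silverman *AEC* VII.2.1–2.2). [cite: SilvermanAEC2009, Props. VII.2.1–VII.2.2] -/
theorem exists_pow_nsmul_eq_of_mem
    (hdiv : ∀ b ∈ AddCommGroup.primaryComponent
        ↥(FixedPoints.addSubgroup ↥((adicCompletionPrime K v).inertia (absoluteGaloisGroup K)) W.geomPoints) p, b ∈ M₀ →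
      ∃ b' ∈ AddCommGroup.primaryComponent
          ↥(FixedPoints.addSubgroup ↥((adicCompletionPrime K v).inertia (absoluteGaloisGroup K)) W.geomPoints) p,
        b' ∈ M₀ ∧ p • b' = b)
    (k : ℕ) :
    ∀ b ∈ AddCommGroup.primaryComponent
        ↥(FixedPoints.addSubgroup ↥((adicCompletionPrime K v).inertia (absoluteGaloisGroup K)) W.geomPoints) p, b ∈ M₀ →
      ∃ b' ∈ AddCommGroup.primaryComponent
          ↥(FixedPoints.addSubgroup ↥((adicCompletionPrime K v).inertia (absoluteGaloisGroup K)) W.geomPoints) p,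
        b' ∈ M₀ ∧ p ^ k • b' = b := by
  induction k with
  | zero => exact fun b hb hbM ↦ ⟨b, hb, hbM, by rw [pow_zero, one_smul]⟩
  | succ k ih =>
    intro b hb hbM
    obtain ⟨b₁, hb₁, hb₁M, rfl⟩ := hdiv b hb hbM
    obtain ⟨b₂, hb₂, hb₂M, rfl⟩ := ih b₁ hb₁ hb₁M
    exact ⟨b₂, hb₂, hb₂M, by rw [pow_succ, mul_smul, smul_comm]⟩

include hφ in
/-- **THE LIFT, generic form.** `M₀ ≤ E(K̄)^{I_v}` `φ`-stable of finite index with `p`-divisible `M₀[p^∞]`, `D_v`-fixed `p`-power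
torsion finite; `c = v_p [E(K̄)^{I_v} : M₀]`. Then for `k ≥ c` and an inertia-fixed `p`-power torsion `y` with `(φ − 1) y ∈ p^k N`:
there is a `p`-power torsion `m` with `(φ − 1) m = 0` and `y − m ∈ p^k N` (`(φ − 1) y ∈ M₀[p^∞] = (φ − 1) M₀[p^∞]`, `M₀[p^∞] ⊆ p^k N`).
[cite: GreenbergLNM1716, §3 Lemma 3.3 (p. 87)] [cite: MilneADT2006, Ch. I Prop. 3.8] -/
theorem exists_sub_mem_ker_inertiaSubOne [W.IsElliptic] [M₀.FiniteIndex]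
    (hM₀ : ∀ x ∈ M₀, inertiaSubOne W.geomPoints φ hφD x ∈ M₀)
    (hdiv : ∀ b ∈ AddCommGroup.primaryComponent
        ↥(FixedPoints.addSubgroup ↥((adicCompletionPrime K v).inertia (absoluteGaloisGroup K)) W.geomPoints) p, b ∈ M₀ →
      ∃ b' ∈ AddCommGroup.primaryComponent
          ↥(FixedPoints.addSubgroup ↥((adicCompletionPrime K v).inertia (absoluteGaloisGroup K)) W.geomPoints) p,
        b' ∈ M₀ ∧ p • b' = b)
    (hfin : Set.Finite {m : W.geomPoints | (∀ x ∈ decomp v, x • m = m) ∧ ∃ k : ℕ, p ^ k • m = 0}) :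
    ∃ c : ℕ, ∀ k, c ≤ k →
      ∀ y ∈ AddCommGroup.primaryComponent
          ↥(FixedPoints.addSubgroup ↥((adicCompletionPrime K v).inertia (absoluteGaloisGroup K)) W.geomPoints) p,
        (∃ z ∈ AddCommGroup.primaryComponent
            ↥(FixedPoints.addSubgroup ↥((adicCompletionPrime K v).inertia (absoluteGaloisGroup K)) W.geomPoints) p,
          inertiaSubOne W.geomPoints φ hφD y = p ^ k • z) →
        ∃ m ∈ AddCommGroup.primaryComponent
            ↥(FixedPoints.addSubgroup ↥((adicCompletionPrime K v).inertia (absoluteGaloisGroup K)) W.geomPoints) p,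
          inertiaSubOne W.geomPoints φ hφD m = 0 ∧
          ∃ z ∈ AddCommGroup.primaryComponent
              ↥(FixedPoints.addSubgroup ↥((adicCompletionPrime K v).inertia (absoluteGaloisGroup K)) W.geomPoints) p,
            y - m = p ^ k • z := by
  set ψ := inertiaSubOne W.geomPoints φ hφD with hψ
  let Mfix := FixedPoints.addSubgroup ↥((adicCompletionPrime K v).inertia (absoluteGaloisGroup K)) W.geomPoints
  let B : AddSubgroup Mfix := AddCommGroup.primaryComponent Mfix p
  obtain ⟨c, hc⟩ := exists_forall_pow_smul_mem (p := p) W M₀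
  have hsurj := exists_inertiaSubOne_eq_of_divisible W hφ hφD M₀ hM₀ hdiv hfin
  refine ⟨c, fun k hk y hy ⟨z, hz, hyz⟩ ↦ ?_⟩
  -- `ψ y = p^k • z ∈ M₀[p^∞]`
  have hzB : p ^ k • z ∈ B := B.nsmul_mem hz _
  have hzM : p ^ k • z ∈ M₀ := hc z hz k hk
  obtain ⟨n₀, hn₀B, hn₀M, hn₀⟩ := hsurj _ hzB hzM
  refine ⟨y - n₀, B.sub_mem hy hn₀B, by rw [map_sub, hn₀, hyz, sub_self], ?_⟩
  obtain ⟨z', hz'B, -, hz'⟩ := exists_pow_nsmul_eq_of_mem W M₀ hdiv k n₀ hn₀B hn₀M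
  exact ⟨z', hz'B, by rw [sub_sub_cancel, hz']⟩

end Generic

/-! ## §2 `M₀ = E₀(K_v^{nr})^{alg}` (route p2's `nonsingularPart`) at a finite place `v ∤ p` -/

section NonsingularPart

/-- **THE LIFT on `E(K̄)^{I_v}` at a finite `v ∤ p` (any reduction type).** For an arithmetic Frobenius `φ ∈ D_v` at `𝔓₀`: there is
`c` such that for all `k ≥ c`, every inertia-fixed `p`-power torsion `y` with `φ y − y ∈ p^k · E(K̄)^{I_v}[p^∞]` is congruent
modulo `p^k · E(K̄)^{I_v}[p^∞]` to a `D_v`-FIXED `p`-power torsion point. (§1 for `M₀ = nonsingularPart`: finite index =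
Kodaira–Néron over `K_v^{nr}`; `M₀[p^∞]` `p`-divisible = Hensel + `Ẽ_ns(k̄)` divisible; `D_v`-fixed torsion finite = VII.3.1 +
VII.6.2; `ker (φ − 1) = E(K̄)^{D_v}`.) [cite: GreenbergLNM1716, §3 Lemma 3.3 (p. 87) and §4 proof of Thm. 4.1 (p. 74)]
[cite: SilvermanAEC2009, Thm. VII.6.1, Cor. VII.6.2, Props. VII.2.1–2.2, VII.3.1] -/
theorem exists_forall_le_lift_fixedPoints [W.IsElliptic] (hpv : (p : 𝓞 K) ∉ v.asIdeal)
    {φ : absoluteGaloisGroup K} (hφ : IsArithFrobAt (𝓞 K) φ (adicCompletionPrime K v)) (hφD : φ ∈ decomp v) :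
    ∃ c : ℕ, ∀ k, c ≤ k →
      ∀ y ∈ AddCommGroup.primaryComponent
          ↥(FixedPoints.addSubgroup ↥((adicCompletionPrime K v).inertia (absoluteGaloisGroup K)) W.geomPoints) p,
        (∃ z ∈ AddCommGroup.primaryComponent
            ↥(FixedPoints.addSubgroup ↥((adicCompletionPrime K v).inertia (absoluteGaloisGroup K)) W.geomPoints) p,
          inertiaSubOne W.geomPoints φ hφD y = p ^ k • z) →
        ∃ m ∈ AddCommGroup.primaryComponent
            ↥(FixedPoints.addSubgroup ↥((adicCompletionPrime K v).inertia (absoluteGaloisGroup K)) W.geomPoints) p,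
          (∀ x ∈ decomp v,
            x • ((m : ↥(FixedPoints.addSubgroup ↥((adicCompletionPrime K v).inertia (absoluteGaloisGroup K)) W.geomPoints)) :
              W.geomPoints) = m) ∧
          ∃ z ∈ AddCommGroup.primaryComponent
              ↥(FixedPoints.addSubgroup ↥((adicCompletionPrime K v).inertia (absoluteGaloisGroup K)) W.geomPoints) p,
            y - m = p ^ k • z := by
  -- local data: spectral valuation, an `𝒪_w`-model of the minimal model, the equivariant transport
  obtain ⟨w, hw⟩ := v.exists_spectralValuation
  obtain ⟨𝔐, h𝔐⟩ := v.localPrimesAbove_nonempty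
  have hint := WeierstrassCurve.isIntegral_spectralValuation_baseChange hw (W.localMinimalIntegralModel v)
  obtain ⟨W₀, hW₀⟩ := hint.integral
  obtain ⟨C, hC⟩ := W.exists_variableChange_eq_localMinimalIntegralModel v
  obtain ⟨Φ, hΦ⟩ := W.exists_addEquiv_localPoints_of_smul_eq v hC
  have hp : IsUnit ((p : ℕ) : v.adicCompletionIntegers K) := by
    have h := isUnit_algebraMap_adicCompletionIntegers K v hpv
    rwa [map_natCast] at h
  -- the four hypotheses of §1 for `M₀ = nonsingularPart`
  haveI := finiteIndex_nonsingularPart hw hW₀ hΦ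
  have hM₀ : ∀ x ∈ nonsingularPart W hW₀ Φ, inertiaSubOne W.geomPoints φ hφD x ∈ nonsingularPart W hW₀ Φ :=
    fun x hx ↦ inertiaSubOne_mem_nonsingularPart hw hW₀ hΦ hφD hx
  have hdiv := exists_nsmul_eq_of_mem_nonsingularPart_of_localDivisible hw hW₀ hΦ h𝔐 hp
    (localDivisible_nonsingular_torsion W v hpv w hw 𝔐 h𝔐)
  have hfin := finite_setOf_smul_decomp_eq_of_isPrimary W p hpv
  obtain ⟨c, hc⟩ := exists_sub_mem_ker_inertiaSubOne W hφ hφD (nonsingularPart W hW₀ Φ) hM₀ hdiv hfin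
  refine ⟨c, fun k hk y hy hyz ↦ ?_⟩
  obtain ⟨m, hm, hm0, z, hz, hyz'⟩ := hc k hk y hy hyz
  exact ⟨m, hm, (inertiaSubOne_eq_zero_iff W hφ hφD m).mp hm0, z, hz, hyz'⟩

end NonsingularPart

end Summit.BirchSwinnertonDyer.BirchSwinnertonDyer.Theorems.ErratumRoadFiveKatoFframeLocalLiftFixedPoints

end
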